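import Literature.Analysis.Asymptotics.LaplaceMethodCompactGroup
import HarnessLib

/-!
# (C3) THE FRAMED EXPONENTIAL CHART IS OPEN AT EVERY POINT OF THE CHART BALL; THE FRAMED HAAR CHART WITH THAT ROW
# (generic input (F3) of the factorised tubular Haar chart, `…S2BetaTreeGaugeChartFactorised`)

Crux `stmt-QuantumFields-20520` (`…Theses.UnitScaleTilt.FluctuationComparisonRegPrIntL`), LINE g18-1 S2β LAPLACE, organ (C3) ∕ row FOUR-POINT-DECAY;
cell `ym3-torus` (HUMAN RULING D-0037 — YM₃ on T³ is ladder rung R3, not the Clay problem), width seat `ym3-torus-px21` g11; count-neutral helper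
(`--kind proof --supports stmt-QuantumFields-20520 --as helper`).  Theorems only: 0 `def`, 0 `instance`, 0 `notation`, 0 `sorry`.

WHAT.  For the tree's «compact group faithfully represented on a log-charted linear group» (lit `HaarExponentialChart.IsChartRep C ρ`, exponential chart
`Θ = h.expChart : 𝔤 → G`, chart radius `s_C`):
* `expChart_image_mem_nhds` — `Θ` IS OPEN AT EVERY POINT OF THE CHART BALL `B(0, s_C)`: `Θ|_{B(0,s_C)}` is a bijection onto the open canonical window with
  inverse the logarithmic chart `Λ = log ∘ ρ` (lit ✓`logChart_expChart`, ✓`expChart_logChart`), and `Λ` is continuous on the open set `‖ρ g − 1‖ < r_C`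
  because `log` is analytic there (lit ✓`MatrixLog.analyticAt_mlog`);
* `expChart_frame_image_mem_nhds` — the same for the framed chart `v ↦ Θ(e v)` of a Euclidean frame `e : V ≃ 𝔤`;
* `exists_haarChart_expChart_frame_open` — lit ✓`Literature.Analysis.Asymptotics.exists_haarChart_expChart_frame` (open `U ∋ 0`, injectivity, continuous
  density `hd ≥ 0` with `hd 0 > 0`, chart identity `μ|_{Θ(e(U))} = (Θ∘e)_*((hd · dv)|_U)`) RE-PACKAGED WITH THE ROW «`Θ ∘ e` is open at every point of
  `U`» (the window is `U = e⁻¹B(0, s_C∕2)`; same 15-line proof as the lit letter).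
WHY.  The lit letter and the landed tubular charts export openness AT THE ORIGIN only; w5-20520 g14's common-tube reading of FOUR-POINT-DECAY ((CT)
`…S2BetaLaplaceInstShift`) re-bases the Laplace instantiation at a SHIFTED point of the window and needs openness there ((F3) of this seat's
`…S2BetaTreeGaugeChartFactorised.exists_tubularChart_of_treeGauge_factorised`).
HONEST SCOPE.  Point-set topology of the exponential chart; nothing of Bałaban's analysis; (CT) ∕ FOUR-POINT-DECAY ∕ LAPLACE ∕ S2β ∕ stmt-QuantumFields-20520
are NOT proved here; rung R3 = YM₃ on T³ — NOT d = 4, NOT infinite volume, NOT a mass gap, NOT Clay.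
[cite: Helgason2000, Ch. I §1 Thm 1.14 (13) p.96; Balaban1985UV3, p.260]
-/

noncomputable section

open MeasureTheory MeasureTheory.Measure Set Function Filter Topology
open scoped ENNReal
open Literature.MathematicalPhysics.QuantumFieldTheory.Balaban1983to89
open Literature.MathematicalPhysics.QuantumFieldTheory.Balaban1983to89.HaarExponentialChart
open Literature.MathematicalPhysics.QuantumFieldTheory.Balaban1983to89.MatrixLog (mlog analyticAt_mlog)
open Literature.MathematicalPhysics.QuantumFieldTheory.Balaban1983to89.B13HaarSigmaJacobian (jac)
open Literature.Analysis.Asymptotics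

namespace Summit.QuantumFields.YangMills.Theorems.FluctuationComparisonRegPrIntLS2BetaExpChartOpen

/-! ## §1  The exponential chart is open at every point of the chart ball -/

section ExpOpen

variable {𝔸 : Type*} [NormedRing 𝔸] [NormedAlgebra ℂ 𝔸] [CompleteSpace 𝔸]
variable {G : Type*} [Group G] [TopologicalSpace G]
variable {C : LogChart 𝔸} {ρ : G →* 𝔸} (h : IsChartRep C ρ)

include h in
/-- ★ **THE EXPONENTIAL CHART IS OPEN AT EVERY POINT OF THE CHART BALL**: for `‖X‖ < s_C`, every neighbourhood of `X` in `𝔤` is mapped by `Θ` onto a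
neighbourhood of `Θ X` in `G`.  (`Θ|_{B(0,s_C)}` has the continuous inverse `Λ = log ∘ ρ` on the open set `‖ρ g − 1‖ < r_C`, lit ✓`logChart_expChart` ∕
✓`expChart_logChart`; `log` is analytic there.) [cite: Helgason2000, Ch. I §1 Thm 1.14 (13) p. 96 (the canonical coordinate neighbourhood)] -/
theorem expChart_image_mem_nhds {X : C.lie} (hX : ‖X‖ < IsChartRep.chartRadius C) {N : Set C.lie} (hN : N ∈ 𝓝 X) :
    h.expChart '' N ∈ 𝓝 (h.expChart X) := by
  set V0 : Set G := {g | ‖ρ g - 1‖ < IsChartRep.innerRadius C} with hV0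
  have hV0o : IsOpen V0 := isOpen_lt (continuous_norm.comp (h.continuous.sub continuous_const)) continuous_const
  -- the logarithmic chart is continuous on `V0`
  have hcont : ContinuousOn h.logChart V0 := by
    rw [Topology.IsInducing.subtypeVal.continuousOn_iff]
    have h1 : ContinuousOn (fun g : G => mlog (ρ g)) V0 := fun g hg => by
      have hg1 : ‖ρ g - 1‖ < 1 := lt_of_lt_of_le hg (IsChartRep.innerRadius_le_half.trans (by norm_num))
      exact ((analyticAt_mlog hg1).continuousAt.comp h.continuous.continuousAt).continuousWithinAt
    exact h1.congr fun g hg => h.coe_logChart hg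
  -- an open set around `Θ X` inside `Θ '' N`
  set O : Set C.lie := interior N ∩ Metric.ball 0 (IsChartRep.chartRadius C) with hO
  have hOo : IsOpen O := isOpen_interior.inter Metric.isOpen_ball
  have hXO : X ∈ O := ⟨mem_interior_iff_mem_nhds.2 hN, mem_ball_zero_iff.2 hX⟩
  have hS : IsOpen (V0 ∩ h.logChart ⁻¹' O) := hcont.isOpen_inter_preimage hV0o hOo
  have hXV0 : h.expChart X ∈ V0 := by
    show ‖ρ (h.expChart X) - 1‖ < IsChartRep.innerRadius C
    rw [h.rho_expChart]
    exact IsChartRep.norm_exp_sub_one_lt hX le_rfl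
  have hmem : h.expChart X ∈ V0 ∩ h.logChart ⁻¹' O :=
    ⟨hXV0, by rw [Set.mem_preimage, h.logChart_expChart hX]; exact hXO⟩
  refine Filter.mem_of_superset (hS.mem_nhds hmem) ?_
  rintro g ⟨hgV, hgO⟩
  exact ⟨h.logChart g, interior_subset hgO.1, h.expChart_logChart hgV⟩

variable {V : Type*} [NormedAddCommGroup V] [NormedSpace ℝ V]

include h in
/-- ★ **THE FRAMED EXPONENTIAL CHART `v ↦ Θ(e v)` IS OPEN AT EVERY POINT OF THE FRAME BALL `‖e v‖ < s_C`** (the frame `e` is a homeomorphism).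
[cite: Helgason2000, Ch. I §1 Thm 1.14 (13) p. 96] -/
theorem expChart_frame_image_mem_nhds (e : V ≃L[ℝ] C.lie) {v : V} (hv : ‖e v‖ < IsChartRep.chartRadius C) {N : Set V} (hN : N ∈ 𝓝 v) :
    (fun v => h.expChart (e v)) '' N ∈ 𝓝 (h.expChart (e v)) := by
  have h1 : (e : V → C.lie) '' N ∈ 𝓝 (e v) := by
    have := e.toHomeomorph.isOpenMap.image_mem_nhds hN
    simpa using this
  have h2 := expChart_image_mem_nhds h hv h1
  rwa [Set.image_image] at h2

end ExpOpen

/-! ## §2  The framed Haar chart, open edition -/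

section FrameChart

variable {𝔸 : Type*} [NormedRing 𝔸] [NormedAlgebra ℂ 𝔸] [CompleteSpace 𝔸]
variable {G : Type*} [Group G] [TopologicalSpace G] [IsTopologicalGroup G] [CompactSpace G]
  [MeasurableSpace G] [BorelSpace G]
variable {C : LogChart 𝔸} {ρ : G →* 𝔸} (h : IsChartRep C ρ) [FiniteDimensional ℝ C.lie]
variable [MeasurableSpace C.lie] [BorelSpace C.lie]
variable {V : Type*} [NormedAddCommGroup V] [InnerProductSpace ℝ V] [FiniteDimensional ℝ V]
  [MeasurableSpace V] [BorelSpace V]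

include h in
/-- ★ **THE FRAMED HAAR CHART, OPEN EDITION**: lit ✓`exists_haarChart_expChart_frame` (an open `U ∋ 0` in the frame on which `v ↦ Θ(e v)` is injective,
a continuous density `hd ≥ 0` with `hd 0 > 0`, and the chart identity `μ|_{Θ(e(U))} = (Θ∘e)_*((hd · dv)|_U)`) WITH THE ROW «`Θ ∘ e` is open at every
point of `U`» (the window is `U = e⁻¹B(0, s_C∕2)`, inside the chart ball, so §0 applies).  Same proof as the lit letter.
[cite: Helgason2000, Ch. I §1 Thm 1.14 (13) p. 96] [cite: Balaban1985UV3, p. 260] -/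
theorem exists_haarChart_expChart_frame_open
    (hlie : ∀ x ∈ C.lie, ∀ y ∈ C.lie, x * y - y * x ∈ C.lie) (μ : Measure G) [μ.IsHaarMeasure] (e : V ≃L[ℝ] C.lie) :
    ∃ (U : Set V) (hd : V → ℝ), IsOpen U ∧ (0 : V) ∈ U ∧ Set.InjOn (fun v => h.expChart (e v)) U ∧
      (∀ v ∈ U, ∀ N ∈ 𝓝 v, (fun v => h.expChart (e v)) '' N ∈ 𝓝 (h.expChart (e v))) ∧
      Continuous hd ∧ (∀ v, 0 ≤ hd v) ∧ 0 < hd 0 ∧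
      μ.restrict ((fun v => h.expChart (e v)) '' U) =
        (((volume : Measure V).restrict U).withDensity fun v => ENNReal.ofReal (hd v)).map
          (fun v => h.expChart (e v)) := by
  haveI : ((volume : Measure V).map e).IsAddHaarMeasure := e.isAddHaarMeasure_map volume
  set s := IsChartRep.chartRadius C with hs_def
  have hs0 : 0 < s := IsChartRep.chartRadius_pos
  have hs2 : s / 2 ≤ s := by linarith
  set σ₀ : ℝ := (μ (h.window s) / h.chartMeasure hlie ((volume : Measure V).map e) s (h.window s)).toReal with hσ₀
  refine ⟨e ⁻¹' Metric.ball (0 : C.lie) (s / 2),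
    fun v => σ₀ * |LinearMap.det (jac hlie (e v) : C.lie →ₗ[ℝ] C.lie)|,
    Metric.isOpen_ball.preimage e.continuous, ?_, ?_, ?_, ?_, ?_, ?_, ?_⟩
  · rw [Set.mem_preimage, map_zero]
    exact Metric.mem_ball_self (by linarith)
  · exact (h.injOn_expChart hs2).comp e.injective.injOn fun v hv => hv
  · intro v hv N hN
    have hv' : ‖e v‖ < IsChartRep.chartRadius C := lt_of_lt_of_le (mem_ball_zero_iff.1 hv) hs2
    exact expChart_frame_image_mem_nhds h e hv' hN
  · exact continuous_const.mul (continuous_abs.comp ((continuous_det_jac hlie).comp e.continuous))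
  · exact fun v => mul_nonneg ENNReal.toReal_nonneg (abs_nonneg _)
  · have hc := h.windowConst_ne_zero_and_ne_top hlie ((volume : Measure V).map e) μ hs0 le_rfl
    have hpos : 0 < σ₀ := ENNReal.toReal_pos hc.1 hc.2
    simpa only [map_zero, B13HaarSigmaJacobian.det_jac_zero, abs_one, mul_one] using hpos
  · exact haar_restrict_window_eq_map_withDensity_frame h hlie μ e

end FrameChart

/-! ## §3  The framed Haar chart, open edition WITH THE DENSITY FORMULA EXPORTED (input of (F4b′) «log jV is a function of det jac») -/

section FrameChartExplicit

variable {𝔸 : Type*} [NormedRing 𝔸] [NormedAlgebra ℂ 𝔸] [CompleteSpace 𝔸]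
variable {G : Type*} [Group G] [TopologicalSpace G] [IsTopologicalGroup G] [CompactSpace G]
  [MeasurableSpace G] [BorelSpace G]
variable {C : LogChart 𝔸} {ρ : G →* 𝔸} (h : IsChartRep C ρ) [FiniteDimensional ℝ C.lie]
variable [MeasurableSpace C.lie] [BorelSpace C.lie]
variable {V : Type*} [NormedAddCommGroup V] [InnerProductSpace ℝ V] [FiniteDimensional ℝ V]
  [MeasurableSpace V] [BorelSpace V]

include h in
/-- ★ **THE FRAMED HAAR CHART, OPEN EDITION, DENSITY EXPLICIT**: the rows of `exists_haarChart_expChart_frame_open` with the density WRITTEN OUT as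
`σ₀ · |det jac(e v)|` (`jac X = (1 − e^{−ad X})∕ad X` on `𝔤`, lit `B13HaarSigmaJacobian.jac`; `σ₀ > 0` the window constant) — so that a consumer can take
LOGARITHMS of the density bond by bond ((F4b′) of `…S2BetaTreeGaugeChartLocal`; DET-REP's (JAC) row).  Same proof as the lit letter.
[cite: Helgason2000, Ch. I §1 Thm 1.14 (13) p. 96] [cite: Balaban1985UV3, p. 260] -/
theorem exists_haarChart_expChart_frame_open_explicit
    (hlie : ∀ x ∈ C.lie, ∀ y ∈ C.lie, x * y - y * x ∈ C.lie) (μ : Measure G) [μ.IsHaarMeasure] (e : V ≃L[ℝ] C.lie) :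
    ∃ (U : Set V) (σ₀ : ℝ), IsOpen U ∧ (0 : V) ∈ U ∧ Set.InjOn (fun v => h.expChart (e v)) U ∧
      (∀ v ∈ U, ∀ N ∈ 𝓝 v, (fun v => h.expChart (e v)) '' N ∈ 𝓝 (h.expChart (e v))) ∧
      0 < σ₀ ∧
      μ.restrict ((fun v => h.expChart (e v)) '' U) =
        (((volume : Measure V).restrict U).withDensity fun v =>
            ENNReal.ofReal (σ₀ * |LinearMap.det (jac hlie (e v) : C.lie →ₗ[ℝ] C.lie)|)).map
          (fun v => h.expChart (e v)) := by
  haveI : ((volume : Measure V).map e).IsAddHaarMeasure := e.isAddHaarMeasure_map volume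
  set s := IsChartRep.chartRadius C with hs_def
  have hs0 : 0 < s := IsChartRep.chartRadius_pos
  have hs2 : s / 2 ≤ s := by linarith
  have hc := h.windowConst_ne_zero_and_ne_top hlie ((volume : Measure V).map e) μ hs0 le_rfl
  refine ⟨e ⁻¹' Metric.ball (0 : C.lie) (s / 2),
    (μ (h.window s) / h.chartMeasure hlie ((volume : Measure V).map e) s (h.window s)).toReal,
    Metric.isOpen_ball.preimage e.continuous, ?_, ?_, ?_, ENNReal.toReal_pos hc.1 hc.2, ?_⟩
  · rw [Set.mem_preimage, map_zero]
    exact Metric.mem_ball_self (by linarith)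
  · exact (h.injOn_expChart hs2).comp e.injective.injOn fun v hv => hv
  · intro v hv N hN
    have hv' : ‖e v‖ < IsChartRep.chartRadius C := lt_of_lt_of_le (mem_ball_zero_iff.1 hv) hs2
    exact expChart_frame_image_mem_nhds h e hv' hN
  · exact haar_restrict_window_eq_map_withDensity_frame h hlie μ e

end FrameChartExplicit

end Summit.QuantumFields.YangMills.Theorems.FluctuationComparisonRegPrIntLS2BetaExpChartOpen

end
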